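import Literature.AlgebraicGeometry.Resolution.ArithmeticalThreefoldsLocalTower
import Literature.AlgebraicGeometry.Resolution.ArithmeticalThreefoldsReduction
import Mathlib.FieldTheory.PurelyInseparable.Basic
import Mathlib.FieldTheory.KummerPolynomial
import Mathlib.FieldTheory.Relrank
import HarnessLib

/-!
# One degree-`p` step of Cossart–Piltant's climb in the ambient field, from step data

Topic: `Literature/AlgebraicGeometry/Resolution`. PROOF side of `CossartPiltant2019ReductionP`
(`ArithmeticalThreefoldsLocal.lean`), continued from `ArithmeticalThreefoldsLocalTower.lean`
(the type-level degree-`p` step `CossartPiltant2019Local.exists_model_step`) and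
`ArithmeticalThreefoldsLocalInseparable.lean` (the purely inseparable part of the climb). In the
proof of journal Prop. 4.10 (arXiv v1 Prop. 4.8, p. 54) the local theorem (Thm. 1.5) is applied
in two places: case (i) along the purely inseparable tower `K ⊇ K^{sep}`, and case (ii) along
the tower of Galois extensions of degree `p` into which `Kʳ | Fʳ` decomposes ("we may assume
`Kʳ|Fʳ` is a single Galois extension of degree `p` … Theorem 1.5 (ii) states that `(LU vʳ)`
holds"). Both applications have the same shape inside an ambient field `Ω`; this file proves
that common shape once:

* `CossartPiltant2019Local.exists_model_adjoin_of_step` — from climbing data at a subfield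
  `M ∋ S` of `Ω` (a model `S[t] ⊆ O_Ω`, `t ⊆ M ⊆ Frac(S)(t)`, regular at the centre of `O_Ω`)
  and STEP DATA on the model — a monic `h ∈ S[t][X]` of degree `p` with `h(x) = 0`,
  `[M(x) : M] = p`, and either (i) `char Ω = p` and `h = X^p + a`, or (ii) `|Aut_M M(x)| = p`
  and, for every `σ`, `b · σ(x) = g(x)` with `g ∈ S[t][X]`, `b ∈ S[t]` a `v`-unit — climbing
  data at `M(x)`. Inside: `K := M` and `L := M(x)` as types, the model pulled back to `K` with
  `Frac = K`, irreducibility of `h` over `K` from the degree, the local theorem over `S[t]_P`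
  through `exists_model_step`, and transport of the new model back to `Ω`.

The Kummer and Artin–Schreier steps of the Galois `p`-tower (radical generators with `σx = ζx`,
resp. `σϑ = ϑ + 1`, rescaled into the model) are instances of (ii); they and the induction along
the `p`-tower are the remaining uses of Thm. 1.5.

Everything is PROVED; no named facts are introduced (the local theorem enters as the hypothesis
`hloc : CossartPiltant2019Local`).

## Sources

* V. Cossart, O. Piltant, J. Algebra 529 (2019) 268–535 = arXiv:1412.0868: journal Thm. 1.5 and
  proof of Prop. 4.10 (arXiv v1: Thm. 1.4 p. 4; Prop. 4.8, proof pp. 53–54). [CossartPiltant2019]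
-/

noncomputable section

open IsLocalRing Polynomial IntermediateField

namespace Literature.AlgebraicGeometry.Resolution

universe u

section Step

variable {S Ω : Type u} [CommRing S] [IsDomain S] [IsLocalRing S] [Field Ω] [Algebra S Ω]
  (OΩ : ValuationSubring Ω)

/-- **One degree-`p` step of the climb, in the ambient field, from step data on the model**
(Cossart–Piltant 2019, proof of Prop. 4.10, arXiv v1 p. 54: the applications of Thm. 1.5 (i)/(ii)
over the local rings of the previous local uniformizations, along the purely inseparable tower
`K ⊇ K^{sep}` and along the Galois `p`-tower `Kʳ ⊇ Fʳ`). Data: `M ⊆ Ω` a subfield containing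
`S`; a model `S[t] ⊆ O_Ω`, `t ⊆ M ⊆ Frac(S)(t)`, regular at the centre of `O_Ω`; a step
`M ⊂ M(x)` of degree `p` given by a monic `h ∈ S[t][X]` of degree `p` with `h(x) = 0`, and
either (i) `char = p` and `h = X^p + a`, or (ii) `|Aut_M M(x)| = p` and for every `σ`,
`b · σ(x) = g(x)` with `g ∈ S[t][X]` and `b ∈ S[t]` a `v`-unit (so that `S[t]_P[x]` is
`σ`-stable). Conclusion: the same kind of data at `M(x)`. This packages the type-level
`CossartPiltant2019Local.exists_model_step` (`K := M`, `L := M(x)`) with the transport between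
the ambient field and the types; `exists_model_adjoin_of_pow_mem`
(`ArithmeticalThreefoldsLocalInseparable.lean`) is its case `h = X^p − x^p`.
[cite: CossartPiltant2019, proof of Prop. 4.10 (arXiv v1: Prop. 4.8, p. 54) with Thm. 1.5] -/
theorem CossartPiltant2019Local.exists_model_adjoin_of_step (hloc : CossartPiltant2019Local.{u})
    (p : ℕ) [hp : Fact p.Prime] [Algebra.IsAlgebraic S Ω]
    (hinj : Function.Injective (algebraMap S Ω))
    (hS : IsExcellentRing S) (hSdim : ringKrullDim S = 3) (hSchar : CharP (ResidueField S) p)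
    (hSO : ∀ s : S, algebraMap S Ω s ∈ OΩ)
    (hdom : ∀ s ∈ maximalIdeal S, OΩ.valuation (algebraMap S Ω s) < 1)
    (hres : ∀ y : OΩ, ∃ q : S[X], (∃ i, q.coeff i ∉ maximalIdeal S) ∧
      OΩ.valuation (q.eval₂ (algebraMap S Ω) y) < 1)
    (M : Subfield Ω) (hSM : ∀ s : S, algebraMap S Ω s ∈ M)
    (t : Finset Ω) (htM : (t : Set Ω) ⊆ M)
    (hMcl : M ≤ Subfield.closure (Set.range (algebraMap S Ω) ∪ (t : Set Ω)))
    (hTO : (Algebra.adjoin S (t : Set Ω)).toSubring ≤ OΩ.toSubring)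
    (hreg : IsRegularLocalRing (Localization.AtPrime
      (Ideal.comap (Subring.inclusion hTO) (maximalIdeal OΩ))))
    (x : Ω) (h₀ : (Algebra.adjoin S (t : Set Ω))[X]) (hmon₀ : h₀.Monic) (hdeg₀ : h₀.natDegree = p)
    (hx₀ : aeval x h₀ = 0)
    (hfin : Module.finrank M (IntermediateField.adjoin M ({x} : Set Ω)) = p)
    (hcase₀ : (CharP Ω p ∧ ∀ i, 0 < i → i < p → h₀.coeff i = 0) ∨
      (Nat.card ((IntermediateField.adjoin M ({x} : Set Ω)) ≃ₐ[M]
          (IntermediateField.adjoin M ({x} : Set Ω))) = p ∧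
        ∀ σ : (IntermediateField.adjoin M ({x} : Set Ω)) ≃ₐ[M]
            (IntermediateField.adjoin M ({x} : Set Ω)),
          ∃ (g : (Algebra.adjoin S (t : Set Ω))[X]) (b : Algebra.adjoin S (t : Set Ω)),
            OΩ.valuation (b : Ω) = 1 ∧
            (b : Ω) * ((σ (IntermediateField.AdjoinSimple.gen M x) :
              IntermediateField.adjoin M ({x} : Set Ω)) : Ω) = aeval x g)) :
    ∃ t' : Finset Ω,
      (t' : Set Ω) ⊆ (IntermediateField.adjoin M ({x} : Set Ω)).toSubfield ∧
      (IntermediateField.adjoin M ({x} : Set Ω)).toSubfield ≤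
        Subfield.closure (Set.range (algebraMap S Ω) ∪ (t' : Set Ω)) ∧
      ∃ hTO' : (Algebra.adjoin S (t' : Set Ω)).toSubring ≤ OΩ.toSubring,
        IsRegularLocalRing (Localization.AtPrime
          (Ideal.comap (Subring.inclusion hTO') (maximalIdeal OΩ))) := by
  classical
  haveI : IsNoetherianRing S := hS.isUniversallyCatenaryRing.1
  -- the base field `K = M` as a type, with `S → K`
  let K : Type u := M
  letI : Algebra S K := ((algebraMap S Ω).codRestrict M hSM).toAlgebra
  haveI : IsScalarTower S K Ω := IsScalarTower.of_algebraMap_eq fun _ => rfl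
  haveI : FaithfulSMul S K := (faithfulSMul_iff_algebraMap_injective _ _).mpr fun a b hab =>
    hinj (by
      have := congrArg (fun z : K => (z : Ω)) hab
      exact this)
  haveI : Algebra.IsAlgebraic S K :=
    Algebra.IsAlgebraic.of_injective (IsScalarTower.toAlgHom S K Ω) Subtype.val_injective
  let val : K →ₐ[S] Ω := IsScalarTower.toAlgHom S K Ω
  have hval : ∀ z : K, val z = (z : Ω) := fun _ => rfl
  -- the step field `L = M(x)` as a type
  let Lx : IntermediateField K Ω := IntermediateField.adjoin K ({x} : Set Ω)
  let L : Type u := Lx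
  letI : Algebra S L := ((algebraMap K L).comp (algebraMap S K)).toAlgebra
  haveI : IsScalarTower S K L := IsScalarTower.of_algebraMap_eq fun _ => rfl
  haveI : IsScalarTower S L Ω := IsScalarTower.of_algebraMap_eq fun _ => rfl
  let valL : L →ₐ[S] Ω := IsScalarTower.toAlgHom S L Ω
  have hvalL : ∀ z : L, valL z = (z : Ω) := fun _ => rfl
  -- the model at level `K`
  have hrange : ∀ e ∈ t, e ∈ Set.range (fun z : K => (z : Ω)) := fun e he =>
    ⟨⟨e, htM (Finset.mem_coe.mpr he)⟩, rfl⟩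
  let tK : Finset K := t.preimage (fun z : K => (z : Ω)) Subtype.val_injective.injOn
  have htK : tK.image (fun z : K => (z : Ω)) = t := by
    rw [Finset.image_preimage]
    exact Finset.filter_true_of_mem hrange
  have htK' : val '' ((tK : Finset K) : Set K) = (t : Set Ω) := by
    rw [← htK, Finset.coe_image]
    rfl
  have hRmap : (Algebra.adjoin S ((tK : Finset K) : Set K)).map val = Algebra.adjoin S (t : Set Ω) := by
    rw [AlgHom.map_adjoin, htK']
  have hRmem : ∀ z : Algebra.adjoin S ((tK : Finset K) : Set K), (z : Ω) ∈ Algebra.adjoin S (t : Set Ω) :=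
    fun z => by
      rw [← hRmap]
      exact Subalgebra.mem_map.mpr ⟨z, z.2, rfl⟩
  have hRpre : ∀ w : Ω, w ∈ Algebra.adjoin S (t : Set Ω) →
      ∃ z : Algebra.adjoin S ((tK : Finset K) : Set K), (z : Ω) = w := fun w hw => by
    rw [← hRmap] at hw
    obtain ⟨z, hz, hzw⟩ := Subalgebra.mem_map.mp hw
    exact ⟨⟨z, hz⟩, hzw⟩
  -- `Frac S[t_K] = K`
  have hfrac : IsFractionRing (Algebra.adjoin S ((tK : Finset K) : Set K)) K := by
    haveI : FaithfulSMul (Algebra.adjoin S ((tK : Finset K) : Set K)) K :=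
      (faithfulSMul_iff_algebraMap_injective _ _).mpr Subtype.val_injective
    refine IsFractionRing.of_field _ K fun z => ?_
    obtain ⟨a, b, ha, hb, hb0, hzab⟩ : ∃ a b : Ω, a ∈ Algebra.adjoin S (t : Set Ω) ∧
        b ∈ Algebra.adjoin S (t : Set Ω) ∧ b ≠ 0 ∧ (z : Ω) = a / b := by
      obtain ⟨y, hy, w, hw, hyw⟩ := Subfield.mem_closure_iff.mp (hMcl z.2)
      rw [← Algebra.adjoin_eq_ring_closure] at hy hw
      by_cases hw0 : w = 0
      · refine ⟨0, 1, zero_mem _, one_mem _, one_ne_zero, ?_⟩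
        rw [← hyw, hw0, div_zero, zero_div]
      · exact ⟨y, w, hy, hw, hw0, hyw.symm⟩
    obtain ⟨a', ha'⟩ := hRpre a ha
    obtain ⟨b', hb'⟩ := hRpre b hb
    refine ⟨a', b', Subtype.ext ?_⟩
    change (z : Ω) = ((a' : K) : Ω) / ((b' : K) : Ω)
    rw [hzab]
    exact congrArg₂ (· / ·) ha'.symm hb'.symm
  -- the valuation on `L`, and the model seen from `L`
  let OL : ValuationSubring L := OΩ.comap (algebraMap L Ω)
  have hOLv : ∀ z : L, OL.valuation z < 1 ↔ OΩ.valuation (z : Ω) < 1 := fun z =>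
    valuation_comap_lt_one_iff OΩ (algebraMap L Ω) z
  have hTO_L : ∀ z : Algebra.adjoin S ((tK : Finset K) : Set K), algebraMap K L z ∈ OL := fun z => by
    change ((z : K) : Ω) ∈ OΩ
    exact hTO (hRmem z)
  -- the centre on `S[t_K]`
  let ιO : Algebra.adjoin S ((tK : Finset K) : Set K) →+* OΩ :=
    ((algebraMap K Ω).comp (Algebra.adjoin S ((tK : Finset K) : Set K)).val.toRingHom).codRestrict
      OΩ (fun z => hTO (hRmem z))
  let P : Ideal (Algebra.adjoin S ((tK : Finset K) : Set K)) := (maximalIdeal OΩ).comap ιO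
  haveI : P.IsPrime := Ideal.IsPrime.comap _
  have hPΩ : ∀ z : Algebra.adjoin S ((tK : Finset K) : Set K), z ∈ P ↔ OΩ.valuation ((z : K) : Ω) < 1 :=
    fun z => by
      rw [Ideal.mem_comap, ValuationSubring.valuation_lt_one_iff]
      rfl
  have hP : ∀ z : Algebra.adjoin S ((tK : Finset K) : Set K), z ∈ P ↔ OL.valuation (algebraMap K L z) < 1 :=
    fun z => by rw [hPΩ, hOLv]; rfl
  -- regularity at level `K`, transported from `Ω`
  set PΩ : Ideal (Algebra.adjoin S (t : Set Ω)) :=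
    Ideal.comap (Subring.inclusion hTO) (maximalIdeal OΩ) with hPΩdef
  haveI : PΩ.IsPrime := Ideal.IsPrime.comap _
  have hPΩmem : ∀ w : Algebra.adjoin S (t : Set Ω), w ∈ PΩ ↔ OΩ.valuation (w : Ω) < 1 := fun w => by
    rw [hPΩdef, Ideal.mem_comap, ValuationSubring.valuation_lt_one_iff]; rfl
  have hmapO : ((Algebra.adjoin S ((tK : Finset K) : Set K)).map val).toSubring ≤ OΩ.toSubring := by
    rw [hRmap]; exact hTO
  set Q : Ideal ((Algebra.adjoin S ((tK : Finset K) : Set K)).map val) :=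
    Ideal.comap (Subring.inclusion hmapO) (maximalIdeal OΩ) with hQdef
  haveI : Q.IsPrime := Ideal.IsPrime.comap _
  have hQ : ∀ y : (Algebra.adjoin S ((tK : Finset K) : Set K)).map val, y ∈ Q ↔ OΩ.valuation (y : Ω) < 1 :=
    fun y => by rw [hQdef, Ideal.mem_comap, ValuationSubring.valuation_lt_one_iff]; rfl
  have hregQ : IsRegularLocalRing (Localization.AtPrime Q) :=
    (isRegularLocalRing_localization_iff_of_subalgebra_eq OΩ hRmap Q hQ PΩ hPΩmem).mpr hreg
  have hregK : IsRegularLocalRing (Localization.AtPrime P) :=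
    (isRegularLocalRing_localization_map_iff val OΩ _ P (fun z => by rw [hPΩ]; rfl) Q hQ).mpr hregQ
  -- `S[t_K] ≅ S[t]`, and the step polynomial over `S[t_K]`
  let e : Algebra.adjoin S ((tK : Finset K) : Set K) ≃ₐ[S] Algebra.adjoin S (t : Set Ω) :=
    ((Algebra.adjoin S ((tK : Finset K) : Set K)).equivMapOfInjective val Subtype.val_injective).trans
      (Subalgebra.equivOfEq _ _ hRmap)
  have he : ∀ z : Algebra.adjoin S ((tK : Finset K) : Set K), ((e z : Algebra.adjoin S (t : Set Ω)) : Ω) =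
      ((z : K) : Ω) := fun _ => rfl
  have he' : ∀ w : Algebra.adjoin S (t : Set Ω),
      (((e.symm w : Algebra.adjoin S ((tK : Finset K) : Set K)) : K) : Ω) = (w : Ω) := fun w => by
    rw [← he, AlgEquiv.apply_symm_apply]
  let eR : Algebra.adjoin S (t : Set Ω) →+* Algebra.adjoin S ((tK : Finset K) : Set K) :=
    e.symm.toRingEquiv.toRingHom
  have heRinj : Function.Injective eR := e.symm.injective
  have hcomp : ((algebraMap K Ω).comp (algebraMap (Algebra.adjoin S ((tK : Finset K) : Set K)) K)).comp eR =
      algebraMap (Algebra.adjoin S (t : Set Ω)) Ω := by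
    ext w
    exact he' w
  let h : (Algebra.adjoin S ((tK : Finset K) : Set K))[X] := h₀.map eR
  have hmon : h.Monic := hmon₀.map _
  have hdeg : h.natDegree = p := by
    rw [Polynomial.natDegree_map_eq_of_injective heRinj, hdeg₀]
  let xL : L := IntermediateField.AdjoinSimple.gen K x
  have hxL : (xL : Ω) = x := IntermediateField.AdjoinSimple.coe_gen K x
  -- `h(x) = 0` read in `Ω`, in `K[X]` and in `L`
  have haevalΩ : aeval x (h.map (algebraMap _ K)) = 0 := by
    rw [aeval_def, eval₂_map, eval₂_map, hcomp, ← aeval_def]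
    exact hx₀
  have hint : IsIntegral K x := ⟨h.map (algebraMap _ K), hmon.map _, by rwa [← aeval_def]⟩
  have hxaeval : aeval xL (h.map (algebraMap _ K)) = 0 := by
    have h1 := aeval_algHom_apply (IsScalarTower.toAlgHom K L Ω) xL (h.map (algebraMap _ K))
    have h2 : (IsScalarTower.toAlgHom K L Ω) xL = x := hxL
    rw [h2, haevalΩ] at h1
    exact (algebraMap L Ω).injective (h1.symm.trans (map_zero _).symm)
  -- irreducibility over `K` from the degree `[K(x) : K] = p`
  have hirr : Irreducible (h.map (algebraMap _ K)) := by
    have hmin : minpoly K x = h.map (algebraMap _ K) := by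
      symm
      apply Polynomial.eq_of_monic_of_dvd_of_natDegree_le (minpoly.monic hint) (hmon.map _)
        (minpoly.dvd K x haevalΩ)
      rw [Polynomial.natDegree_map_eq_of_injective
          (show Function.Injective (algebraMap (Algebra.adjoin S ((tK : Finset K) : Set K)) K) from
            Subtype.val_injective), hdeg, ← IntermediateField.adjoin.finrank hint, hfin]
    rw [← hmin]
    exact minpoly.irreducible hint
  have hgen : Algebra.adjoin K ({xL} : Set L) = ⊤ := by
    have := PowerBasis.adjoin_gen_eq_top (IntermediateField.adjoin.powerBasis hint)
    rwa [IntermediateField.adjoin.powerBasis_gen] at this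
  -- the case distinction, transported to `S[t_K]`
  have hcase : (CharP K p ∧ ∀ i, 0 < i → i < p → h.coeff i = 0) ∨
      (Nat.card (L ≃ₐ[K] L) = p ∧ ∀ σ : L ≃ₐ[K] L,
        ∃ (g : (Algebra.adjoin S ((tK : Finset K) : Set K))[X])
          (b : Algebra.adjoin S ((tK : Finset K) : Set K)), b ∉ P ∧
          algebraMap K L b * σ xL = aeval xL (g.map (algebraMap _ K))) := by
    rcases hcase₀ with ⟨hchar, hcoeff⟩ | ⟨hcard, hstab⟩
    · refine Or.inl ⟨(RingHom.charP_iff_charP (algebraMap K Ω) p).mpr hchar, fun i hi hip => ?_⟩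
      rw [Polynomial.coeff_map, hcoeff i hi hip, map_zero]
    · refine Or.inr ⟨hcard, fun σ => ?_⟩
      obtain ⟨g₀, b₀, hb1, heq⟩ := hstab σ
      refine ⟨g₀.map eR, eR b₀, ?_, ?_⟩
      · rw [hPΩ]
        change ¬ OΩ.valuation ((((e.symm b₀ : Algebra.adjoin S ((tK : Finset K) : Set K)) : K) : Ω)) < 1
        rw [he', hb1]
        exact lt_irrefl 1
      · apply (algebraMap L Ω).injective
        rw [map_mul]
        have h1 := aeval_algHom_apply (IsScalarTower.toAlgHom K L Ω) xL
          ((g₀.map eR).map (algebraMap _ K))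
        have h2 : (IsScalarTower.toAlgHom K L Ω) xL = x := hxL
        rw [h2] at h1
        change _ = algebraMap L Ω (aeval xL ((g₀.map eR).map (algebraMap _ K))) at h1
        rw [← h1, aeval_def, eval₂_map, eval₂_map, hcomp, ← aeval_def, ← heq]
        congr 1
        rw [← IsScalarTower.algebraMap_apply]
        exact he' b₀
  -- the valuation data at level `L`
  have hSO_L : ∀ s : S, algebraMap S L s ∈ OL := fun s => by
    change algebraMap L Ω (algebraMap S L s) ∈ OΩ
    rw [← IsScalarTower.algebraMap_apply]
    exact hSO s
  have hdom_L : ∀ s ∈ maximalIdeal S, OL.valuation (algebraMap S L s) < 1 := fun s hs => by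
    rw [hOLv]
    change OΩ.valuation (algebraMap L Ω (algebraMap S L s)) < 1
    rw [← IsScalarTower.algebraMap_apply]
    exact hdom s hs
  have hres_L : ∀ y : OL, ∃ q : S[X], (∃ i, q.coeff i ∉ maximalIdeal S) ∧
      OL.valuation (q.eval₂ (algebraMap S L) y) < 1 := fun y => by
    obtain ⟨q, hq, hv⟩ := hres ⟨algebraMap L Ω y, y.2⟩
    refine ⟨q, hq, ?_⟩
    rw [hOLv]
    change OΩ.valuation (algebraMap L Ω (q.eval₂ (algebraMap S L) y)) < 1
    rw [Polynomial.hom_eval₂, ← IsScalarTower.algebraMap_eq]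
    exact hv
  -- the local theorem
  obtain ⟨t', hTO', hfrac', hreg'⟩ := CossartPiltant2019Local.exists_model_step hloc p hp.out hS
    hSdim hSchar OL hSO_L hdom_L hres_L tK hTO_L hfrac P hP hregK h xL hmon hdeg hirr hxaeval hgen
    hcase
  -- back to `Ω`
  haveI := hfrac'
  let t'' : Finset Ω := t'.image (fun z : L => (z : Ω))
  have ht'' : valL '' ((t' : Finset L) : Set L) = ((t'' : Finset Ω) : Set Ω) := by
    rw [Finset.coe_image]
    rfl
  have hmap' : (Algebra.adjoin S ((t' : Finset L) : Set L)).map valL =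
      Algebra.adjoin S ((t'' : Finset Ω) : Set Ω) := by
    rw [AlgHom.map_adjoin, ht'']
  refine ⟨t'', ?_, ?_, ?_⟩
  · intro w hw
    obtain ⟨z, -, rfl⟩ := Finset.mem_image.mp (Finset.mem_coe.mp hw)
    exact (IntermediateField.mem_toSubfield _ _).mpr z.2
  · intro w hw
    let wL : L := ⟨w, (IntermediateField.mem_toSubfield _ _).mp hw⟩
    obtain ⟨a, b, hb, hab⟩ := IsFractionRing.div_surjective (A := Algebra.adjoin S ((t' : Finset L) : Set L)) wL
    have hmemcl : ∀ z : Algebra.adjoin S ((t' : Finset L) : Set L),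
        ((z : L) : Ω) ∈ Subfield.closure (Set.range (algebraMap S Ω) ∪ ((t'' : Finset Ω) : Set Ω)) := by
      intro z
      have h1 : ((z : L) : Ω) ∈ Algebra.adjoin S ((t'' : Finset Ω) : Set Ω) := by
        rw [← hmap']
        exact Subalgebra.mem_map.mpr ⟨z, z.2, rfl⟩
      have h2 : ((z : L) : Ω) ∈ (Algebra.adjoin S ((t'' : Finset Ω) : Set Ω)).toSubring := h1
      rw [Algebra.adjoin_eq_ring_closure] at h2
      exact Subfield.subring_closure_le _ h2
    have hw' : w = ((a : L) : Ω) / ((b : L) : Ω) := by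
      have := congrArg (fun z : L => (z : Ω)) hab
      change ((algebraMap _ L a / algebraMap _ L b : L) : Ω) = w at this
      rw [← this]
      rfl
    rw [hw']
    exact div_mem (hmemcl a) (hmemcl b)
  · have hTO'' : (Algebra.adjoin S ((t'' : Finset Ω) : Set Ω)).toSubring ≤ OΩ.toSubring := by
      intro w hw
      rw [← hmap'] at hw
      obtain ⟨z, hz, rfl⟩ := Subalgebra.mem_map.mp hw
      exact hTO' hz
    refine ⟨hTO'', ?_⟩
    -- transport the regularity from `L` to `Ω`
    set P₁ : Ideal (Algebra.adjoin S ((t' : Finset L) : Set L)) :=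
      Ideal.comap (Subring.inclusion hTO') (maximalIdeal OL) with hP₁def
    have hP₁ : ∀ z : Algebra.adjoin S ((t' : Finset L) : Set L), z ∈ P₁ ↔ OΩ.valuation (valL z) < 1 :=
      fun z => by
        rw [hP₁def, Ideal.mem_comap, ValuationSubring.valuation_lt_one_iff, hvalL]
        exact hOLv _
    set Q₁ : Ideal ((Algebra.adjoin S ((t' : Finset L) : Set L)).map valL) :=
      Ideal.comap (Subring.inclusion (show ((Algebra.adjoin S ((t' : Finset L) : Set L)).map valL).toSubring ≤
        OΩ.toSubring by rw [hmap']; exact hTO'')) (maximalIdeal OΩ) with hQ₁def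
    haveI : Q₁.IsPrime := Ideal.IsPrime.comap _
    have hQ₁ : ∀ y : (Algebra.adjoin S ((t' : Finset L) : Set L)).map valL, y ∈ Q₁ ↔ OΩ.valuation (y : Ω) < 1 :=
      fun y => by rw [hQ₁def, Ideal.mem_comap, ValuationSubring.valuation_lt_one_iff]; rfl
    have hregQ₁ : IsRegularLocalRing (Localization.AtPrime Q₁) :=
      (isRegularLocalRing_localization_map_iff valL OΩ _ P₁ hP₁ Q₁ hQ₁).mp hreg'
    set P₂ : Ideal (Algebra.adjoin S ((t'' : Finset Ω) : Set Ω)) :=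
      Ideal.comap (Subring.inclusion hTO'') (maximalIdeal OΩ) with hP₂def
    haveI : P₂.IsPrime := Ideal.IsPrime.comap _
    exact (isRegularLocalRing_localization_iff_of_subalgebra_eq OΩ hmap' Q₁ hQ₁ P₂ (fun y => by
      rw [hP₂def, Ideal.mem_comap, ValuationSubring.valuation_lt_one_iff]; rfl)).mp hregQ₁


end Step

end Literature.AlgebraicGeometry.Resolution
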